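import Literature.Topology.FourManifolds.PropertyRTraceClosing
import Literature.Topology.FourManifolds.OneOneHandlebodyBoundary
import Literature.Topology.FourManifolds.SliceGenusUnknotLeaves
import HarnessLib

/-!
# Property R in `4`-dimensional handle form: the residue after the landed leaves

Topic `Literature/Topology/FourManifolds`; fact seat
`provefact-Literature.Topology.FourManifolds.proper-8cbb123206` of the named fact
`Literature.Topology.FourManifolds.propertyR_exists_isBoundaryGluing_sphere_four`
(`PropertyRTraceClosing.lean`: a compact `4`-dimensional `(1,0,1)`-handlebody `P = B⁴ ∪ h²` whose
boundary is that of a compact connected orientable `(1,1)`-handlebody is one piece of a splitting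
`S⁴ = P ∪_{φ'} V'` of the round `4`-sphere, the other piece again a `(1,1)`-handlebody —
Gompf–Scharlemann–Thompson, *Geom. Topol.* 14 (2010) 2305–2347, arXiv:1103.1601: Thm. 1.1
(Property R, D. Gabai, J. Differential Geom. 26 (1987), Cor. 8.3), §2, p. 4 of the arXiv text
(*"In the case `n = 1` no slides are possible, so Conjecture 1 does indeed directly generalize
Theorem 1.1"*; Prop. 2.2: the framing is `0`) and the proof of Prop. 9.2, p. 20 (*"Since there
are no `1`-handles, the `2`-handles are attached to some framed `n`-component link `L ⊂ S³` in
the boundary of the unique `0`-handle `D⁴` … there are `n` 3-handles attached to the resulting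
boundary, showing that surgery on `L` is `#ₙ(S¹ × S²)` … there is an obvious way to attach some
set of `3`-handles so that they exactly cancel the `2`-handles, creating `S⁴`"*)).  Everything
here is **proved**; no definition and no named fact is introduced.

`PropertyRTraceClosing.lean` reduces the fact, with proof
(`propertyR_exists_isBoundaryGluing_sphere_four_of_leaves`), to four leaves.  Two of them have
since been discharged in the tree:

* (B) `nonempty_diffeomorph_boundary_sphereTwo_prod_of_handleCount_one_one` — the boundary of a
  compact connected orientable `(1,1)`-handlebody is `S² × S¹` (Kirby 1989, Ch. I §2, p. 8) — by
  `nonempty_diffeomorph_boundary_sphereTwo_prod_of_handleCount_one_one_holds`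
  (`OneOneHandlebodyBoundary.lean`);
* (D) `Knot.isUnknot_of_hasSeifertSurfaceOfGenus_zero` — a knot bounding a smoothly embedded disc
  is the unknot (Cromwell 2004, Ch. 5, p. 103; Hirsch 1976, Ch. 8, Thm. 3.1) — by
  `Knot.isUnknot_of_hasSeifertSurfaceOfGenus_zero_holds` (`SliceGenusUnknotLeaves.lean`).

This file records the exact residue, so that the discharge
`propertyR_exists_isBoundaryGluing_sphere_four_holds` is one application away from proofs of the
two remaining named facts:

* (G) `Knot.hasSeifertSurfaceOfGenus_le_of_isIntegralSurgery_zero` (`SurgeryGluckPropertyR.lean`)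
  — Gabai (1987), Cor. 8.3, genus clause: a `0`-surgery on `K` containing a nonseparating closed
  orientable surface of genus `g` forces a Seifert surface of genus `≤ g` (sutured manifold
  hierarchies, Thm. 3.1 and Cor. 8.2 there, with Thurston's norm; this is THE Property R input);
* (T) `exists_framedKnot_of_hasHandleDecomposition_oneZeroOne` (`PropertyRTraceClosing.lean`) —
  a `(1,0,1)`-handlebody is the trace of a framed knot `(K, n)`: its boundary is the integral
  surgery `S³ₙ(K)`, and the `0`-framed unknot trace closes up to the round `S⁴` with a
  `(1,1)`-handlebody complement (Milnor 1963, Thm. 3.2; Kirby 1989, Ch. I §§1–2).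

## Contents

* `propertyR_exists_isBoundaryGluing_sphere_four_of_trace_of_gabai` — the fact from (T) and (G);
* `nonempty_diffeomorph_sphere_of_isBoundaryGluing_oneTwoHandle_of_trace_of_gabai_of_laudenbachPoenaru`
  — GST Prop. 9.2 for one `2`-handle (`X = P ∪_φ V ≅ S⁴`) from (T), (G) and Laudenbach–Poénaru's
  extension theorem (`exists_diffeomorph_comp_incl_eq`, `SPC4Handles.lean`), i.e.
  `nonempty_diffeomorph_sphere_of_isBoundaryGluing_oneTwoHandle_of_facts` with its Property R
  hypothesis so reduced.

## References

* R. E. Gompf, M. Scharlemann, A. Thompson, *Fibered knots and potential counterexamples to the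
  Property 2R and Slice-Ribbon Conjectures*, Geom. Topol. 14 (2010) 2305–2347, arXiv:1103.1601:
  Thm. 1.1, §2 (p. 4), Prop. 2.2, Prop. 9.2 and its proof (p. 20). [GompfScharlemannThompson2010]
* D. Gabai, *Foliations and the topology of 3-manifolds. III*, J. Differential Geom. 26 (1987)
  479–536, Cor. 8.3, Remark 8.5. [GabaiJDG1987]
* R. C. Kirby, *The topology of 4-manifolds*, LNM 1374 (1989), Ch. I §§1–2 (p. 8). [Kirby1989]
* F. Laudenbach, V. Poénaru, Bull. Soc. Math. France 100 (1972) 337–344. [LaudenbachPoenaruBSMF1972]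

## Design notes

* A sibling file rather than an append: `OneOneHandlebodyBoundary.lean` (the discharge of (B))
  imports `PropertyRTraceClosing.lean`, so the residue cannot be stated there without an import
  cycle.
* Universe `0` throughout, as in the fact.
-/

open scoped Manifold ContDiff Topology
open Set Function

noncomputable section

namespace Literature.Topology.FourManifolds

/-- **Property R in handle form, from the knot-trace fact and Gabai's Corollary 8.3.**  GIVEN
(T) `exists_framedKnot_of_hasHandleDecomposition_oneZeroOne` (a `(1,0,1)`-handlebody is the trace
of a framed knot, `∂P = S³ₙ(K)`, and the `0`-framed unknot trace closes up to `S⁴`) and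
(G) Gabai (1987), Cor. 8.3, genus clause (`Knot.hasSeifertSurfaceOfGenus_le_of_isIntegralSurgery_zero`),
the named fact `propertyR_exists_isBoundaryGluing_sphere_four` holds: this is
`propertyR_exists_isBoundaryGluing_sphere_four_of_leaves` with its other two leaves discharged by
the tree's theorems `nonempty_diffeomorph_boundary_sphereTwo_prod_of_handleCount_one_one_holds`
(`∂(S¹ × B³) ≅ S² × S¹`, Kirby 1989, Ch. I §2, p. 8) and
`Knot.isUnknot_of_hasSeifertSurfaceOfGenus_zero_holds` (a knot bounding a disc is trivial).  The
argument is Gompf–Scharlemann–Thompson (2010), §2 for `n = 1` (Prop. 2.2: the framing is `0`;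
Thm. 1.1: `K` is the unknot) inside the proof of Prop. 9.2.
[cite: GompfScharlemannThompson2010, Thm. 1.1, §2 (n = 1), Prop. 2.2 and proof of Prop. 9.2]
[cite: GabaiJDG1987, Cor. 8.3 and Remark 8.5] [cite: Kirby1989, Ch. I §2, p. 8] -/
theorem propertyR_exists_isBoundaryGluing_sphere_four_of_trace_of_gabai
    (hT : exists_framedKnot_of_hasHandleDecomposition_oneZeroOne)
    (h83 : Knot.hasSeifertSurfaceOfGenus_le_of_isIntegralSurgery_zero.{0}) :
    propertyR_exists_isBoundaryGluing_sphere_four :=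
  propertyR_exists_isBoundaryGluing_sphere_four_of_leaves hT
    nonempty_diffeomorph_boundary_sphereTwo_prod_of_handleCount_one_one_holds h83
    Knot.isUnknot_of_hasSeifertSurfaceOfGenus_zero_holds

/-- **GST Prop. 9.2 for one `2`-handle, from the knot-trace fact, Gabai's Corollary 8.3 and
Laudenbach–Poénaru.**  A closed smooth `4`-manifold `X = P ∪_φ V` glued from a compact
`(1,0,1)`-handlebody `P` and a compact connected orientable `(1,1)`-handlebody `V` is
diffeomorphic to the round `S⁴`, GIVEN (T), (G) and Laudenbach–Poénaru's extension theorem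
(`exists_diffeomorph_comp_incl_eq`): `nonempty_diffeomorph_sphere_of_isBoundaryGluing_oneTwoHandle_of_facts`
with its Property R hypothesis supplied by
`propertyR_exists_isBoundaryGluing_sphere_four_of_trace_of_gabai`.  Gompf–Scharlemann–Thompson
(2010), proof of Prop. 9.2 (p. 20 of arXiv:1103.1601), case `n = 1`, `r = s = 0`: *"It is a
theorem of Laudenbach and Poenaru that, up to handle-slides, there is really only one way to
attach `(n+r)` `3`-handles to `Σ₂`.  Hence `Σ` is diffeomorphic to `S⁴` as required."*
[cite: GompfScharlemannThompson2010, proof of Prop. 9.2 (n = 1) with Thm. 1.1]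
[cite: GabaiJDG1987, Cor. 8.3] [cite: LaudenbachPoenaruBSMF1972, main theorem] -/
theorem nonempty_diffeomorph_sphere_of_isBoundaryGluing_oneTwoHandle_of_trace_of_gabai_of_laudenbachPoenaru
    (hT : exists_framedKnot_of_hasHandleDecomposition_oneZeroOne)
    (h83 : Knot.hasSeifertSurfaceOfGenus_le_of_isIntegralSurgery_zero.{0})
    (hLP : exists_diffeomorph_comp_incl_eq.{0})
    {X : Type} [TopologicalSpace X] [ChartedSpace (EuclideanSpace ℝ (Fin 4)) X] [IsManifold (𝓡 4) ∞ X]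
    (P V : Type) [TopologicalSpace P] [T2Space P] [SecondCountableTopology P]
    [ChartedSpace (EuclideanHalfSpace 4) P] [IsManifold (𝓡∂ 4) ∞ P] [CompactSpace P]
    [TopologicalSpace V] [T2Space V] [SecondCountableTopology V] [CompactSpace V] [ConnectedSpace V]
    [ChartedSpace (EuclideanHalfSpace 4) V] [IsManifold (𝓡∂ 4) ∞ V]
    (hP : HasHandleDecomposition 3 P (fun k => if k = 0 then 1 else if k = 2 then 1 else 0))
    (hV : HasHandleDecomposition 3 V (handleCount 1 1)) (hoV : IsOrientable (𝓡∂ 4) V)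
    {bP : BoundaryData (𝓡∂ 4) P (𝓡 3)} {bV : BoundaryData (𝓡∂ 4) V (𝓡 3)}
    {φ : bP.carrier ≃ₘ⟮𝓡 3, 𝓡 3⟯ bV.carrier} (hX : IsBoundaryGluing bP bV φ (𝓡 4) X) :
    Nonempty (X ≃ₘ⟮𝓡 4, 𝓡 4⟯ (Metric.sphere (0 : EuclideanSpace ℝ (Fin 5)) 1)) :=
  nonempty_diffeomorph_sphere_of_isBoundaryGluing_oneTwoHandle_of_facts
    (propertyR_exists_isBoundaryGluing_sphere_four_of_trace_of_gabai hT h83) hLP P V hP hV hoV hX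

end Literature.Topology.FourManifolds

end
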